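import Literature.NumberTheory.EllipticCurves.NewformPeterssonSizeCMReductionProofs
import Literature.NumberTheory.EllipticCurves.ComplexMultiplicationDeuring0Square
import Literature.NumberTheory.LFunctions.EisensteinGrossencharacterEuler
import Literature.NumberTheory.LFunctions.EisensteinGrossencharacterLFunction
import Mathlib.NumberTheory.LegendreSymbol.QuadraticChar.GaussSum
import HarnessLib

/-!
# `L(Sym² f, 1) ≫_ε N^{−ε}` for the newforms of the elliptic curves with `j = 0`
# (the CM case `K = ℚ(ζ₃)` of Hoffstein–Lockhart, via the cubic Grössencharacters of `ℚ(ζ₃)`), proved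

Topic `NumberTheory/EllipticCurves`; namespace `Literature.NumberTheory.EllipticCurves.ModularForms`.
Everything is PROVED (theorems; the definitions `chi3C`, `cubeFree`, `cubePart`, `discNat`, `dPar`,
`cmCorrectionWith`, `cmCorrection0` have bodies; no named fact, D-0026). Filed in support of the named fact
`murty_petersson_newform_lower_bound` (`NewformPeterssonSize.lean`; Murty 1999 §2 (3) ⇐ Hoffstein–Lockhart
1994 Thm. 0.1). The tree reduces that fact (`murty_petersson_newform_lower_bound_of_pairData_nonCM_of_j_zero`,
`NewformPeterssonSizeCMReductionProofs`) to (A) `GL₃ × GL₃` pair data for the non-CM, non-twist-equivalent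
pairs of elliptic newforms and (B) the bound `hCM0 : ∀ ε > 0 ∃ c > 0, c N^{−ε} ≤ symmSqLOne f` on the single
CM family `j = 0` (the curves `y² = x³ + k`, CM by `ℤ[ζ₃]`). This file PROVES (B):

* `exists_symmSqL_one_re_ge_of_j_eq_zero` — **for every `ε > 0` there is `c > 0` with
  `c N^{−ε} ≤ Re L_f(1)`** for every elliptic `W/ℚ` with `j(W) = 0` and every `f ∈ S₂(Γ₀(N))` with
  `IsNewformOf W f` (`L_f = symmSqL N f`, `L_f(1) = 8π³ Re(f,f)/[SL₂(ℤ):Γ₀(N)]`);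
* `exists_symmSqLOne_ge_of_j_eq_zero` — the same as `c N^{−ε} ≤ symmSqLOne j.f` (the shape of `hCM0`);
* `exists_petersson_ge_of_j_eq_zero` — **`c N^{1−ε} ≤ Re (f,f)_{Γ₀(N)}`** on this family, i.e. the
  statement of `murty_petersson_newform_lower_bound` there;
* `murty_petersson_newform_lower_bound_of_pairData_nonCM'` / `_cmJ'` — **the named fact now follows from
  the pair data (A) alone** (Hoffstein–Lockhart's Lemma 1.2 for the non-CM pairs; not in the tree).

## The argument (Ireland–Rosen Ch. 18 §§3, 6 for `Sym²`; Hoffstein–Lockhart Thm. 0.1, the CM case)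

Let `W` be globally minimal with `j = 0` (any model is reduced to this by `hasGlobalMinimalModel_rat_holds`,
`LFunction_smul`, `variableChange_j`), `Δ = Δ_min(W)`, and put
`d_W = 8N³ · cubeFree|Δ|` (`dPar`; `|d_W| ≤ 8N⁵` because every prime of `Δ` divides `N`,
`IsNewformOf.natAbs_dPar_le`; no Szpiro-type input). Let `ν_W = ν_{d_W,1,2}` be the Grössencharakter of
`K3 = ℚ(ζ₃)` of `EisensteinGrossencharacterSums`: `ν_W(𝔞) = e(χ_𝔞(d_W)) · (e(α)/|e(α)|)²` for `𝔞 = (α)`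
prime to `3d_W` with `α` primary, `χ` the cubic residue symbol, `e : K3 → ℂ`. For real `σ > 1`

  `L_f(σ) = L(σ, χ₋₃) · L(σ, ν_W) · E_W(σ)`,  `E_W(σ) = ∏_{p ∣ 6N} F_p(σ)(1 − χ₋₃(p)p^{−σ})`

(`IsNewformOf.symmSqL_ofReal_eq0`), comparing Euler products prime by prime:
`L_f(σ) = ζ(2σ)L(|a|², σ+1)/ζ(σ) = ∏_p F_p(σ)` (`IsNewform0.tendsto_prod_symmSqLocal`),
`L(σ, ν_W) = ∏_p G_p(σ)` (`hasProd_localFactor`, `EisensteinGrossencharacterEuler`) with `G_p = 1` for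
`p ∣ 3d_W ⊇ primes of 6N`, and at `p ∤ 6N`:

* `p ≡ 1 (3)`, `p = N(v)`, `v = (ϖ)`, `ϖ ≡ 1 (3)`: `a_p(W)² = e(χ_v(Δ))e(ϖ)² + conj + 2p`
  (`frobeniusTrace_sq_of_j_eq_zero`, Ireland–Rosen 18.3 Thm. 4 squared), `χ_v(Δ) = χ_v(d_W)` (the two differ
  by the cube `(±t · (2N)⁻¹)³` at `v`, `IsNewformOf.cubicResidueSymbol_minimalDiscriminantInt_eq`), so with
  `u = ν_W(v)`, `|u| = 1`: `a_p² = p(u + ū) + 2p` and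
  `F_p = (1 − p^{−σ})⁻¹(1 − u p^{−σ})⁻¹(1 − ū p^{−σ})⁻¹ = L_p(χ₋₃) G_p` (`ν_W(v̄) = conj ν_W(v)`,
  `localFactor_of_split`; `IsNewformOf.symmSqLocal_eq_of_mod_three_eq_one`);
* `p ≡ 2 (3)`: `a_p(W) = 0` (`frobeniusTrace_eq_zero_of_j_eq_zero_of_mod_three_eq_two`), `χ₋₃(p) = −1`,
  `G_p = (1 − p^{−2σ})⁻¹`, `F_p = ((1 − p^{−σ})(1 + p^{−σ})²)⁻¹ = L_p(χ₋₃) G_p`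
  (`IsNewformOf.symmSqLocal_eq_of_mod_three_eq_two`).

Letting `σ → 1⁺` (`L_f` is holomorphic at `1`; `L(s, χ₋₃)` is Mathlib's `DirichletCharacter.LFunction`;
`L(s, ν_W) = grossenL d_W 1 2` is holomorphic on `Re s > 3/4` (`EisensteinGrossencharacterLFunction`, from
the partial-sum bound `Σ_{N𝔞 ≤ x} ν_W(𝔞) = O(x^{3/4})` of `EisensteinGrossencharacterSums`); `E_W` is a finite
product with non-vanishing denominators at `1`) gives `L_f(1) = L(1, χ₋₃) L(1, ν_W) E_W(1)`
(`IsNewformOf.symmSqL_one_eq0`). Finally `L(1, χ₋₃) ≠ 0` (Mathlib),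
`|L(1, ν_W)| ≥ c₀/(log Q + log 4)³` (`exists_norm_grossenL_one_ge`: the twisted zero-free region package
`TwistedZFRLOne` for `ν_W`, which has no exceptional zero since `ν_W²` has frequency `4 ≠ 0`) with
`Q = 16 C_w N((9d_W)) ≤ 82944 C_w N^{10}` (`IsNewformOf.condQ_dPar_le`), and
`|E_W(1)| ≥ ∏_{p∣6N}(1 − 1/p)³ ≥ (K(δ)(6N)^δ)⁻³`; with `δ = ε/33` this is `c(ε) N^{−ε}`
(`IsNewformOf.exists_symmSqL_one_ge_of_isGloballyMinimal_of_j_eq_zero`). All constants are effective in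
principle; no Siegel-type ineffectivity enters.

## References

* J. Hoffstein, P. Lockhart, *Coefficients of Maass forms and the Siegel zero*, Ann. of Math. 140
  (1994), Thm. 0.1 (for CM forms `L(s, Sym² f)` factors through `GL(1)` and the bound is classical),
  Lemma 1.2. [cite: HoffsteinLockhart1994, Thm. 0.1]
* K. Ireland, M. Rosen, *A Classical Introduction to Modern Number Theory*, 2nd ed., GTM 84 (1990),
  Ch. 9 §3 (cubic residue character), Ch. 18 §3 Thm. 4 (`y² = x³ + D` and Jacobi sums), §6 Thm. 7 and its
  proof (`L(E, s)` is a Hecke `L`-series with Grössencharakter; here for `Sym²`).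
  [cite: IrelandRosen1990, Ch. 18 §6, Theorem 7]
* E. Hecke, *Eine neue Art von Zetafunktionen und ihre Beziehungen zur Verteilung der Primzahlen II*,
  Math. Z. 6 (1920), §6. [cite: HeckeMathZ1920, §6]
* M. R. Murty, *Bounds for congruence primes*, Proc. Sympos. Pure Math. 66.1 (1999), §2 (3).
  [cite: MurtyCongruencePrimes1999, §2 (3)]

## Mathlib / tree search

Tree: `symmSqLocal`, `IsNewform0.tendsto_prod_symmSqLocal`, `prime_cpow_neg_ofReal`, `split_algebra`,
`symmSqLocalClosed`, `IsNewform0.symmSqLocal_eq_closed`, `IsNewformOf.symmSqLocalClosed_one`,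
`continuous_prime_cpow_neg`, `continuousAt_symmSqL_ofReal_one`, `prod_one_sub_inv_le_prod`,
`prod_one_sub_pos`, `symmSqL_one_re_eq_norm`, `IsNewformOf.not_dvd_minimalDiscriminantInt_of_not_dvd`,
`IsNewformOf.cuspCoeff_eq_frobeniusTrace_of_not_dvd`, `tendsto_prod_primesBelow_of_hasProd`
(`NewformSymmSquareJ1728Hecke`, the `j = 1728` twin of this file);
`murty_petersson_newform_lower_bound_of_pairData_nonCM_of_j_zero/_cmJ_of_j_zero`
(`NewformPeterssonSizeCMReductionProofs`); `frobeniusTrace_sq_of_j_eq_zero`,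
`frobeniusTrace_eq_zero_of_j_eq_zero_of_mod_three_eq_two` (`ComplexMultiplicationDeuring0Square`);
`grossenNu`, `embC`, `hζ`, `Cw`, `three`, `mkInt_intCast`, `absNorm_span_mkInt` (`EisensteinGrossencharacterSums`,
`EisensteinFieldIntegers/Primes`); `grossenL`, `differentiableOn_grossenL`, `grossenL_eq_LSeries`, `condQ`, `C0`,
`one_le_condQ`, `exists_norm_grossenL_one_ge` (`EisensteinGrossencharacterLFunction`); `localFactor`,
`hasProd_localFactor`, `localFactor_of_dvd/_of_mod_three_eq_two/_of_split`, `exists_split_data`,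
`intCast_not_mem`, `three_not_mem` (`EisensteinGrossencharacterEuler`); `cubicResidueSymbol`,
`cubicResidueSymbol_mul/_spec` (`CubicResidueSymbol`); `sectorWeight` (`PlaneLatticeCosetSectorSums`);
`locSq`, `IsNewform0.locSq_eq_of_not_dvd`, `exists_prod_primeFactors_one_add_div_le`
(`RankinSymmSquareTwistComparison`); `symmSqL_one_re_le_symmSqLOne`, `EllipticNewformIndex`, `TwistEquiv`;
`hasGlobalMinimalModel_rat_holds`, `WeierstrassCurve.LFunction_smul`, `re_peterssonProduct_self_nonneg`,
`le_gamma0Index`. Mathlib: `quadraticChar`, `quadraticChar_two`, `ZMod.χ₈_nat_eq_if_mod_eight`,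
`DirichletCharacter.LSeries_eulerProduct`, `DirichletCharacter.LFunction_eq_LSeries`,
`DirichletCharacter.differentiable_LFunction`, `DirichletCharacter.LFunction_apply_one_ne_zero`,
`Nat.factorization`, `Int.sign_mul_abs`, `Real.log_le_rpow_div`, `pow_eq_one_iff_of_nonneg`.
-/

noncomputable section

open scoped Real Topology
open Set Filter Complex CongruenceSubgroup LSeries
open Literature.NumberTheory.LFunctions Literature.NumberTheory.LFunctions.EisensteinGrossen
open Literature.NumberTheory.NumberFields Literature.NumberTheory.NumberFields.K3
open Literature.NumberTheory.GaloisRepresentations Literature.NumberTheory.LFunctions.PlaneLattice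

namespace Literature.NumberTheory.EllipticCurves.ModularForms

/-! ### The character `χ₋₃` -/

/-- **`χ₋₃`**, the quadratic Dirichlet character modulo `3` (the Kronecker symbol `(−3/·)`), with
complex values. [folklore] -/
def chi3C : DirichletCharacter ℂ 3 := (quadraticChar (ZMod 3)).ringHomComp (Int.castRingHom ℂ)

/-- `χ₋₃(n) = quadraticChar (ZMod 3) n`. [folklore] -/
theorem chi3C_apply (n : ℕ) : chi3C n = ((quadraticChar (ZMod 3) n : ℤ) : ℂ) := by
  simp [chi3C]

/-- `χ₋₃(p) = 1` for `p ≡ 1 (mod 3)`. [folklore] -/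
theorem chi3C_of_mod_three_eq_one {p : ℕ} (hp : p % 3 = 1) : chi3C p = 1 := by
  rw [chi3C_apply, show ((p : ℕ) : ZMod 3) = 1 from by
    rw [← ZMod.natCast_mod, hp]; rfl, MulChar.map_one]
  simp

/-- `χ₋₃(p) = −1` for `p ≡ 2 (mod 3)`. [folklore] -/
theorem chi3C_of_mod_three_eq_two {p : ℕ} (hp : p % 3 = 2) : chi3C p = -1 := by
  rw [chi3C_apply, show ((p : ℕ) : ZMod 3) = 2 from by
    rw [← ZMod.natCast_mod, hp]; rfl]
  have h2 : quadraticChar (ZMod 3) 2 = -1 := by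
    rw [quadraticChar_two (by rw [ZMod.ringChar_zmod_n]; norm_num), ZMod.card,
      ZMod.χ₈_nat_eq_if_mod_eight]
    norm_num
  rw [h2]; simp

/-- `χ₋₃ ≠ 1`. [folklore] -/
theorem chi3C_ne_one : chi3C ≠ 1 := by
  intro h
  have := chi3C_of_mod_three_eq_two (p := 2) (by norm_num)
  rw [h, MulChar.one_apply (by rw [show ((2 : ℕ) : ZMod 3) = -1 from rfl]; exact isUnit_one.neg)] at this
  norm_num at this

/-- `‖χ₋₃(n)‖ ≤ 1`. [folklore] -/
theorem norm_chi3C_le (n : ℕ) : ‖chi3C n‖ ≤ 1 := DirichletCharacter.norm_le_one chi3C _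

/-- `L(1, χ₋₃) ≠ 0`. [folklore] -/
theorem norm_chi3C_LFunction_one_pos : 0 < ‖chi3C.LFunction 1‖ :=
  norm_pos_iff.mpr (DirichletCharacter.LFunction_apply_one_ne_zero chi3C_ne_one)

/-! ### The cube-free kernel of an integer -/

/-- The cube-free kernel `∏_p p^{v_p(n) mod 3}`. [folklore] -/
def cubeFree (n : ℕ) : ℕ := ∏ p ∈ n.primeFactors, p ^ (n.factorization p % 3)

/-- The cube part `∏_p p^{⌊v_p(n)/3⌋}`. [folklore] -/
def cubePart (n : ℕ) : ℕ := ∏ p ∈ n.primeFactors, p ^ (n.factorization p / 3)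

/-- **`n = cubePart(n)³ · cubeFree(n)`** (`n ≠ 0`). [folklore] -/
theorem cubePart_pow_mul_cubeFree {n : ℕ} (hn : n ≠ 0) : cubePart n ^ 3 * cubeFree n = n := by
  conv_rhs => rw [← Nat.prod_factorization_pow_eq_self hn]
  rw [Finsupp.prod, Nat.support_factorization, cubePart, cubeFree, ← Finset.prod_pow,
    ← Finset.prod_mul_distrib]
  refine Finset.prod_congr rfl fun p _ ↦ ?_
  rw [← pow_mul, ← pow_add, Nat.div_add_mod']

/-- `cubeFree n ∣ n`. [folklore] -/
theorem cubeFree_dvd {n : ℕ} (hn : n ≠ 0) : cubeFree n ∣ n :=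
  ⟨cubePart n ^ 3, by rw [mul_comm]; exact (cubePart_pow_mul_cubeFree hn).symm⟩

/-- `cubePart n ∣ n`. [folklore] -/
theorem cubePart_dvd {n : ℕ} (hn : n ≠ 0) : cubePart n ∣ n :=
  ⟨cubePart n ^ 2 * cubeFree n, by
    conv_lhs => rw [← cubePart_pow_mul_cubeFree hn]
    ring⟩

/-- `cubeFree n ≠ 0`. [folklore] -/
theorem cubeFree_ne_zero (n : ℕ) : cubeFree n ≠ 0 :=
  Finset.prod_ne_zero_iff.mpr fun _ hp ↦ pow_ne_zero _ (Nat.prime_of_mem_primeFactors hp).ne_zero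

/-- **`cubeFree n ≤ (∏_{p ∣ n} p)²`** (each exponent is `≤ 2`). [folklore] -/
theorem cubeFree_le (n : ℕ) : cubeFree n ≤ (∏ p ∈ n.primeFactors, p) ^ 2 := by
  rw [cubeFree, ← Finset.prod_pow]
  refine Finset.prod_le_prod' fun _ hp ↦ ?_
  exact Nat.pow_le_pow_right (Nat.prime_of_mem_primeFactors hp).pos (by omega)

/-! ### The Grössencharakter parameter of a `j = 0` curve: `d_W = 8 N³ · cubeFree|Δ_min|` -/

section CMData0

open _root_.WeierstrassCurve

variable (W : WeierstrassCurve ℚ) [W.IsElliptic] [W.IsGloballyMinimal] (N : ℕ)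

/-- `|Δ_min|` as a natural number. [folklore] -/
def discNat : ℕ := (minimalDiscriminantInt W).natAbs

/-- `|Δ_min| ≠ 0`. [folklore] -/
theorem discNat_ne_zero : discNat W ≠ 0 :=
  Int.natAbs_ne_zero.mpr (minimalDiscriminantInt_ne_zero W)

omit [W.IsElliptic] in
/-- A natural divisor of `|Δ_min|` divides `Δ_min`. [folklore] -/
theorem natCast_dvd_minimalDiscriminantInt_of_dvd {p : ℕ} (h : p ∣ discNat W) :
    (p : ℤ) ∣ minimalDiscriminantInt W := by
  have h2 : (p : ℤ) ∣ (discNat W : ℤ) := Int.natCast_dvd_natCast.mpr h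
  rwa [discNat, Int.natCast_natAbs, dvd_abs] at h2

/-- **The parameter** `d_W = 8 N³ · cubeFree|Δ_min|` of the Grössencharakter `ν_W = ν_{d_W,1,2}`: the cube
factors do not change the cubic symbols `χ_v(d_W) = χ_v(Δ_min)` at the good primes `∤ 6N`, the factor
`8N³` kills the local factors at every `p ∣ 6N`, and `|d_W| ≤ 8N⁵`. [folklore] -/
def dPar : ℤ := 8 * (N : ℤ) ^ 3 * (cubeFree (discNat W) : ℤ)

omit [W.IsElliptic] in
/-- `d_W ≠ 0`. [folklore] -/
theorem dPar_ne_zero [NeZero N] : dPar W N ≠ 0 := by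
  have hN : (N : ℤ) ≠ 0 := by exact_mod_cast NeZero.ne N
  have hc : (cubeFree (discNat W) : ℤ) ≠ 0 := by exact_mod_cast cubeFree_ne_zero _
  unfold dPar
  exact mul_ne_zero (mul_ne_zero (by norm_num) (pow_ne_zero 3 hN)) hc

omit [W.IsElliptic] in
/-- Every prime of `6N` divides `3 d_W`. [folklore] -/
theorem dvd_three_mul_dPar_of_dvd {p : ℕ} (hp : p.Prime) (h : p ∣ 6 * N) : (p : ℤ) ∣ 3 * dPar W N := by
  unfold dPar
  rcases (Nat.Prime.dvd_mul hp).mp h with h6 | hN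
  · have h6' : p ∣ 2 * 3 := by simpa using h6
    rcases (Nat.Prime.dvd_mul hp).mp h6' with h2 | h3
    · have hp2 : p = 2 := (Nat.prime_dvd_prime_iff_eq hp Nat.prime_two).mp h2
      subst hp2
      exact ⟨3 * 4 * (N : ℤ) ^ 3 * cubeFree (discNat W), by push_cast; ring⟩
    · have hp3 : p = 3 := (Nat.prime_dvd_prime_iff_eq hp Nat.prime_three).mp h3
      subst hp3
      exact ⟨8 * (N : ℤ) ^ 3 * cubeFree (discNat W), by push_cast; ring⟩
  · obtain ⟨k, hk⟩ := hN
    refine ⟨3 * 8 * (k : ℤ) * (N : ℤ) ^ 2 * cubeFree (discNat W), ?_⟩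
    have : (N : ℤ) = p * k := by exact_mod_cast hk
    rw [this]; ring

variable {W N} {f : CuspForm (Gamma0 N) 2} [NeZero N]

/-- **A prime `p ∤ 6N` does not divide `3 d_W`** (`p ∤ N ⇒ p ∤ Δ_min ⇒ p ∤ cubeFree|Δ_min|`).
[folklore] -/
theorem IsNewformOf.not_dvd_three_mul_dPar (hf : IsNewformOf W f) {p : ℕ} (hp : p.Prime)
    (h : ¬ p ∣ 6 * N) : ¬ (p : ℤ) ∣ 3 * dPar W N := by
  haveI : Fact p.Prime := ⟨hp⟩
  have hp2 : p ≠ 2 := by rintro rfl; exact h (dvd_mul_of_dvd_left (by norm_num) _)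
  have hp3 : p ≠ 3 := by rintro rfl; exact h (dvd_mul_of_dvd_left (by norm_num) _)
  have hpN : ¬ p ∣ N := fun hN ↦ h (dvd_mul_of_dvd_right hN 6)
  have hΔ := (hf.not_dvd_minimalDiscriminantInt_of_not_dvd hpN).2
  have hp' : Prime (p : ℤ) := Nat.prime_iff_prime_int.mp hp
  intro hd
  unfold dPar at hd
  rcases hp'.dvd_or_dvd hd with h3 | hd
  · have : p ∣ 3 := by exact_mod_cast h3
    exact hp3 ((Nat.prime_dvd_prime_iff_eq hp Nat.prime_three).mp this)
  rcases hp'.dvd_or_dvd hd with h8N | hc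
  · rcases hp'.dvd_or_dvd h8N with h8 | hN3
    · have : p ∣ 2 ^ 3 := by exact_mod_cast h8
      exact hp2 ((Nat.prime_dvd_prime_iff_eq hp Nat.prime_two).mp (hp.dvd_of_dvd_pow this))
    · have : (p : ℤ) ∣ N := hp'.dvd_of_dvd_pow hN3
      exact hpN (by exact_mod_cast this)
  · have hc' : p ∣ cubeFree (discNat W) := by exact_mod_cast hc
    exact hΔ (natCast_dvd_minimalDiscriminantInt_of_dvd W
      (hc'.trans (cubeFree_dvd (discNat_ne_zero W))))

/-- **`|d_W| ≤ 8 N⁵`**: the bad primes divide `N`, and `cubeFree|Δ| ≤ rad(Δ)² ≤ rad(N)² ≤ N²`.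
[folklore] -/
theorem IsNewformOf.natAbs_dPar_le (hf : IsNewformOf W f) : ((dPar W N).natAbs : ℝ) ≤ 8 * (N : ℝ) ^ 5 := by
  have hN0 : N ≠ 0 := NeZero.ne N
  -- `rad(Δ) ∣`-type comparison: the prime factors of `Δ_min` are among those of `N`
  have hsub : (discNat W).primeFactors ⊆ N.primeFactors := by
    intro p hp
    have hpp := Nat.prime_of_mem_primeFactors hp
    haveI : Fact p.Prime := ⟨hpp⟩
    rw [Nat.mem_primeFactors_of_ne_zero hN0]
    refine ⟨hpp, ?_⟩
    by_contra hpN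
    exact (hf.not_dvd_minimalDiscriminantInt_of_not_dvd hpN).2
      (natCast_dvd_minimalDiscriminantInt_of_dvd W (Nat.dvd_of_mem_primeFactors hp))
  have hrad : ∏ p ∈ (discNat W).primeFactors, p ≤ N := by
    calc ∏ p ∈ (discNat W).primeFactors, p ≤ ∏ p ∈ N.primeFactors, p :=
          Finset.prod_le_prod_of_subset_of_one_le' hsub fun p hp _ ↦ (Nat.prime_of_mem_primeFactors hp).one_lt.le
      _ ≤ N := Nat.le_of_dvd (Nat.pos_of_ne_zero hN0) (Nat.prod_primeFactors_dvd N)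
  have hcf : cubeFree (discNat W) ≤ N ^ 2 :=
    (cubeFree_le _).trans (Nat.pow_le_pow_left hrad 2)
  have habs : (dPar W N).natAbs = 8 * N ^ 3 * cubeFree (discNat W) := by
    unfold dPar
    rw [Int.natAbs_mul, Int.natAbs_mul, Int.natAbs_pow]
    simp
  rw [habs]
  have : (8 * N ^ 3 * cubeFree (discNat W) : ℕ) ≤ 8 * N ^ 5 := by
    calc 8 * N ^ 3 * cubeFree (discNat W) ≤ 8 * N ^ 3 * N ^ 2 := by gcongr
      _ = 8 * N ^ 5 := by ring
  exact_mod_cast this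

end CMData0

/-! ### `χ_v(Δ_min) = χ_v(d_W)` at the primes of `𝓞 K3` above the good primes `p ∤ 6N` -/

section Symbols

open _root_.WeierstrassCurve NumberField IsDedekindDomain

variable {W : WeierstrassCurve ℚ} [W.IsElliptic] [W.IsGloballyMinimal] {N : ℕ} [NeZero N]
  {f : CuspForm (Gamma0 N) 2}

/-- `χ_v(a³) = χ_v(a)³`. [cite: IrelandRosen1990, Ch. 9 §3 Prop. 9.3.3] -/
theorem cubicResidueSymbol_pow_three (v : HeightOneSpectrum (𝓞 K3)) (a : 𝓞 K3 ⧸ v.asIdeal) :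
    cubicResidueSymbol v (a ^ 3) = cubicResidueSymbol v a ^ 3 := by
  rw [pow_succ, pow_two, cubicResidueSymbol_mul hζ, cubicResidueSymbol_mul hζ]; ring

/-- **Cube factors drop out**: `χ_v(y³ x) = χ_v(x)` for `y ∉ v`, `v ∤ 3`.
[cite: IrelandRosen1990, Ch. 9 §3 Prop. 9.3.3] -/
theorem cubicResidueSymbol_cube_mul (v : HeightOneSpectrum (𝓞 K3)) (h3v : (3 : 𝓞 K3) ∉ v.asIdeal)
    {y : 𝓞 K3} (hy : y ∉ v.asIdeal) (x : 𝓞 K3) :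
    cubicResidueSymbol v (Ideal.Quotient.mk v.asIdeal (y ^ 3 * x)) =
      cubicResidueSymbol v (Ideal.Quotient.mk v.asIdeal x) := by
  have hy0 : Ideal.Quotient.mk v.asIdeal y ≠ 0 := fun h ↦ hy (Ideal.Quotient.eq_zero_iff_mem.mp h)
  obtain ⟨hcube, -⟩ := cubicResidueSymbol_spec hζ h3v hy0
  rw [map_mul, cubicResidueSymbol_mul hζ, map_pow, cubicResidueSymbol_pow_three, hcube, one_mul]

/-- `χ_v((y³ x)) = χ_v((x))` for rational integers, `(y) ∉ v`, `v ∤ 3`.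
[cite: IrelandRosen1990, Ch. 9 §3 Prop. 9.3.3] -/
theorem cubicResidueSymbol_intCast_cube_mul (v : HeightOneSpectrum (𝓞 K3))
    (h3v : (3 : 𝓞 K3) ∉ v.asIdeal) {y : ℤ} (hy : ((y : ℤ) : 𝓞 K3) ∉ v.asIdeal) (x : ℤ) :
    cubicResidueSymbol v (Ideal.Quotient.mk v.asIdeal ((y ^ 3 * x : ℤ) : 𝓞 K3)) =
      cubicResidueSymbol v (Ideal.Quotient.mk v.asIdeal ((x : ℤ) : 𝓞 K3)) := by
  have e : ((y ^ 3 * x : ℤ) : 𝓞 K3) = ((y : ℤ) : 𝓞 K3) ^ 3 * ((x : ℤ) : 𝓞 K3) := by push_cast; ring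
  rw [e, cubicResidueSymbol_cube_mul v h3v hy]

/-- **`χ_v(Δ_min) = χ_v(d_W)`** for every prime `v` of `𝓞 K3` above a prime `p ∤ 6N`
(`Δ_min = (±t)³ · cubeFree|Δ|`, `d_W = (2N)³ · cubeFree|Δ|`, and `±t, 2N ∉ v`). [folklore] -/
theorem IsNewformOf.cubicResidueSymbol_minimalDiscriminantInt_eq (hf : IsNewformOf W f) {p : ℕ}
    (hp : p.Prime) (h6N : ¬ p ∣ 6 * N) (v : HeightOneSpectrum (𝓞 K3))
    (hpv : ((p : ℤ) : 𝓞 K3) ∈ v.asIdeal) :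
    cubicResidueSymbol v (Ideal.Quotient.mk v.asIdeal (minimalDiscriminantInt W : 𝓞 K3)) =
      cubicResidueSymbol v (Ideal.Quotient.mk v.asIdeal ((dPar W N : ℤ) : 𝓞 K3)) := by
  haveI : Fact p.Prime := ⟨hp⟩
  have hp2 : p ≠ 2 := by rintro rfl; exact h6N (dvd_mul_of_dvd_left (by norm_num) _)
  have hp3 : p ≠ 3 := by rintro rfl; exact h6N (dvd_mul_of_dvd_left (by norm_num) _)
  have hpN : ¬ p ∣ N := fun hN ↦ h6N (dvd_mul_of_dvd_right hN 6)
  have hΔ := (hf.not_dvd_minimalDiscriminantInt_of_not_dvd hpN).2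
  have h3v : (3 : 𝓞 K3) ∉ v.asIdeal := three_not_mem hp hp3 hpv
  have hp' : Prime (p : ℤ) := Nat.prime_iff_prime_int.mp hp
  -- the factorisations `Δ_min = (sign Δ · t)³ · c`, `d_W = (2N)³ · c`
  have hfac : ((cubePart (discNat W) : ℕ) : ℤ) ^ 3 * ((cubeFree (discNat W) : ℕ) : ℤ) =
      (discNat W : ℤ) := by
    exact_mod_cast cubePart_pow_mul_cubeFree (discNat_ne_zero W)
  have hs3 : (minimalDiscriminantInt W).sign ^ 3 = (minimalDiscriminantInt W).sign := by
    rcases lt_or_gt_of_ne (minimalDiscriminantInt_ne_zero W) with h | h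
    · rw [Int.sign_eq_neg_one_of_neg h]; norm_num
    · rw [Int.sign_eq_one_of_pos h]; norm_num
  have hΔeq : minimalDiscriminantInt W =
      ((minimalDiscriminantInt W).sign * (cubePart (discNat W) : ℕ)) ^ 3 *
        ((cubeFree (discNat W) : ℕ) : ℤ) := by
    have h1 : (minimalDiscriminantInt W).sign * (discNat W : ℤ) = minimalDiscriminantInt W := by
      rw [discNat, Int.natCast_natAbs, Int.sign_mul_abs]
    calc minimalDiscriminantInt W = (minimalDiscriminantInt W).sign * (discNat W : ℤ) := h1.symm
      _ = (minimalDiscriminantInt W).sign ^ 3 *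
            (((cubePart (discNat W) : ℕ) : ℤ) ^ 3 * ((cubeFree (discNat W) : ℕ) : ℤ)) := by
          rw [hfac, hs3]
      _ = _ := by ring
  have hdeq : dPar W N = (2 * (N : ℤ)) ^ 3 * ((cubeFree (discNat W) : ℕ) : ℤ) := by
    unfold dPar; ring
  -- `p` divides neither cube root
  have hndvd1 : ¬ (p : ℤ) ∣ (minimalDiscriminantInt W).sign * (cubePart (discNat W) : ℕ) := by
    intro h
    apply hΔ
    rw [hΔeq]
    exact dvd_mul_of_dvd_left (dvd_pow h (by norm_num)) _
  have hndvd2 : ¬ (p : ℤ) ∣ 2 * (N : ℤ) := by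
    intro h
    rcases hp'.dvd_or_dvd h with h2 | hN'
    · have : p ∣ 2 := by exact_mod_cast h2
      exact hp2 ((Nat.prime_dvd_prime_iff_eq hp Nat.prime_two).mp this)
    · exact hpN (by exact_mod_cast hN')
  rw [hΔeq, hdeq, cubicResidueSymbol_intCast_cube_mul v h3v (intCast_not_mem hp hpv hndvd1),
    cubicResidueSymbol_intCast_cube_mul v h3v (intCast_not_mem hp hpv hndvd2)]

end Symbols

/-! ### Norms: `|e(χ_v(a))| = 1`, `|w_m(z)| = 1` -/

section NormOne

open NumberField IsDedekindDomain

/-- `‖e(χ_v(a))‖ = 1` for `v ∤ 3`, `a ≢ 0 (mod v)` (`χ_v(a)³ = 1`). [cite: IrelandRosen1990, Ch. 9 §3 Prop. 9.3.3] -/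
theorem norm_embC_cubicResidueSymbol (v : HeightOneSpectrum (𝓞 K3)) (h3v : (3 : 𝓞 K3) ∉ v.asIdeal)
    {a : 𝓞 K3 ⧸ v.asIdeal} (ha : a ≠ 0) :
    ‖embC ((cubicResidueSymbol v a : 𝓞 K3) : K3)‖ = 1 := by
  obtain ⟨hcube, -⟩ := cubicResidueSymbol_spec hζ h3v ha
  have e : ((cubicResidueSymbol v a ^ 3 : 𝓞 K3) : K3) = ((cubicResidueSymbol v a : 𝓞 K3) : K3) ^ 3 :=
    map_pow (algebraMap (𝓞 K3) K3) _ _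
  have h : ‖embC ((cubicResidueSymbol v a : 𝓞 K3) : K3)‖ ^ 3 = 1 := by
    rw [← norm_pow, ← map_pow, ← e, hcube]
    simp
  exact (pow_eq_one_iff_of_nonneg (norm_nonneg _) (by norm_num)).mp h

/-- `‖w_m(z)‖ = 1` for `z ≠ 0`. [folklore] -/
theorem norm_sectorWeight_eq_one (m : ℕ) {z : ℂ} (hz : z ≠ 0) : ‖sectorWeight m z‖ = 1 := by
  unfold sectorWeight
  rw [norm_pow, norm_div, Complex.norm_real, Real.norm_of_nonneg (norm_nonneg _),
    div_self (norm_ne_zero_iff.mpr hz), one_pow]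

/-- `(p²)^{−σ} = (p^{−σ})²` in `ℂ`, for real `σ`. [folklore] -/
theorem prime_sq_cpow_neg_ofReal (p : ℕ) (σ : ℝ) :
    ((p : ℂ) ^ 2) ^ (-(σ : ℂ)) = ((((p : ℝ) ^ (-σ)) ^ 2 : ℝ) : ℂ) := by
  have hp0 : (0 : ℝ) ≤ p := Nat.cast_nonneg p
  have h1 : ((p : ℂ) ^ 2) = ((((p : ℝ) ^ 2 : ℝ)) : ℂ) := by
    rw [Complex.ofReal_pow, Complex.ofReal_natCast]
  rw [h1, ← Complex.ofReal_neg, ← Complex.ofReal_cpow (by positivity)]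
  congr 1
  rw [← Real.rpow_natCast (p : ℝ) 2, ← Real.rpow_mul hp0, ← Real.rpow_natCast ((p : ℝ) ^ (-σ)) 2,
    ← Real.rpow_mul hp0]
  congr 1
  have h2 : ((2 : ℕ) : ℝ) = 2 := by norm_num
  rw [h2]
  ring

end NormOne

/-! ### The local identities at the primes `p ∤ 6N` -/

section LocalIdentities0

open _root_.WeierstrassCurve NumberField IsDedekindDomain
open scoped ComplexConjugate

variable {W : WeierstrassCurve ℚ} [W.IsElliptic] [W.IsGloballyMinimal] {N : ℕ} [NeZero N]
  {f : CuspForm (Gamma0 N) 2}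

/-- **The split local identity** (`j = 0`). For the newform `f` of a globally minimal `W` with `j = 0`,
real `σ > 1` and a prime `p ≡ 1 (3)` with `p ∤ 6N`:
`F_p(σ) = (1 − χ₋₃(p) p^{−σ})⁻¹ · G_p(σ)`, `G_p` the local factor of `L(s, ν_W)`, `ν_W = ν_{d_W,1,2}`
(both sides equal `((1 − p^{−σ})(1 − u p^{−σ})(1 − ū p^{−σ}))⁻¹` with `u = ν_W(v) = e(χ_v(d_W))(e(ϖ)/|e(ϖ)|)²`:
the good local factor of `Σ|a_n|²n^{−w}`, `a_p² = p u + p ū + 2p` (`frobeniusTrace_sq_of_j_eq_zero` and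
`χ_v(Δ_min) = χ_v(d_W)`), `|u| = 1`). [cite: IrelandRosen1990, Ch. 18 §6, proof of Theorem 7] -/
theorem IsNewformOf.symmSqLocal_eq_of_mod_three_eq_one (hf : IsNewformOf W f) (hj : W.j = 0) {σ : ℝ}
    (hσ : 1 < σ) {p : ℕ} (hp : p.Prime) (h6N : ¬ p ∣ 6 * N) (hp1 : p % 3 = 1) :
    symmSqLocal f σ p = (1 - chi3C p * (p : ℂ) ^ (-(σ : ℂ)))⁻¹ * localFactor (dPar W N) 1 2 p σ := by
  haveI : Fact p.Prime := ⟨hp⟩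
  have hp2 : p ≠ 2 := by rintro rfl; exact h6N (dvd_mul_of_dvd_left (by norm_num) _)
  have hp3 : p ≠ 3 := by rintro rfl; exact h6N (dvd_mul_of_dvd_left (by norm_num) _)
  have hpN : ¬ p ∣ N := fun hN ↦ h6N (dvd_mul_of_dvd_right hN 6)
  have hΔ := (hf.not_dvd_minimalDiscriminantInt_of_not_dvd hpN).2
  have hpd := hf.not_dvd_three_mul_dPar hp h6N
  obtain ⟨v, ϖ, hne, hover, hpv, hdeg, -, hϖ, hϖ1, hnϖ, hval⟩ := exists_split_data hp hp1
  have h3v : (3 : 𝓞 K3) ∉ v.asIdeal := three_not_mem hp hp3 hpv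
  rw [localFactor_of_split (dPar W N) 1 2 hne hover hdeg, chi3C_of_mod_three_eq_one hp1]
  -- the value `u = ν_W(v)`, `|u| = 1`
  set u : ℂ := grossenNu ((dPar W N : ℤ) : 𝓞 K3) 1 2 v.asIdeal with hu_def
  have hu : u = embC ((cubicResidueSymbol v (Ideal.Quotient.mk v.asIdeal ((dPar W N : ℤ) : 𝓞 K3)) :
      𝓞 K3) : K3) * sectorWeight 2 (embC (ϖ : K3)) := by
    rw [hu_def, hval (dPar W N) 1 2 hpd, pow_one]
  have hp0R : (0 : ℝ) < p := by exact_mod_cast hp.pos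
  have hϖ0 : embC (ϖ : K3) ≠ 0 := by
    intro h0
    rw [h0, norm_zero] at hnϖ
    have : (p : ℝ) = 0 := by rw [← hnϖ]; norm_num
    linarith
  have hdv : Ideal.Quotient.mk v.asIdeal ((dPar W N : ℤ) : 𝓞 K3) ≠ 0 := by
    rw [Ne, Ideal.Quotient.eq_zero_iff_mem]
    exact intCast_not_mem hp hpv fun h ↦ hpd (dvd_mul_of_dvd_right h 3)
  have hnu1 : ‖u‖ = 1 := by
    rw [hu, norm_mul, norm_embC_cubicResidueSymbol v h3v hdv, norm_sectorWeight_eq_one 2 hϖ0, one_mul]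
  have huv' : u * conj u = 1 := by
    rw [Complex.mul_conj, Complex.normSq_eq_norm_sq, hnu1]; simp
  -- `a_p² = p u + conj (p u) + 2p`
  have hpv' : (p : 𝓞 K3) ∈ v.asIdeal := by rwa [Int.cast_natCast] at hpv
  have ht2 : ((W.frobeniusTrace p : ℤ) : ℂ) ^ 2 =
      embC ((cubicResidueSymbol v (Ideal.Quotient.mk v.asIdeal (minimalDiscriminantInt W : 𝓞 K3)) :
          𝓞 K3) : K3) * embC (ϖ : K3) ^ 2 +
        conj (embC ((cubicResidueSymbol v (Ideal.Quotient.mk v.asIdeal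
          (minimalDiscriminantInt W : 𝓞 K3)) : 𝓞 K3) : K3) * embC (ϖ : K3) ^ 2) + 2 * p :=
    frobeniusTrace_sq_of_j_eq_zero hζ W hj hp hp2 hp3 hΔ (embC : K3 →ₐ[ℚ] ℂ).toRingHom
      hpv' hdeg hϖ hϖ1
  rw [hf.cubicResidueSymbol_minimalDiscriminantInt_eq hp h6N v hpv] at ht2
  have hpu : embC ((cubicResidueSymbol v (Ideal.Quotient.mk v.asIdeal ((dPar W N : ℤ) : 𝓞 K3)) :
      𝓞 K3) : K3) * embC (ϖ : K3) ^ 2 = (p : ℂ) * u := by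
    rw [hu, sectorWeight]
    have hn : ((‖embC (ϖ : K3)‖ : ℂ)) ^ 2 = (p : ℂ) := by
      rw [← Complex.ofReal_pow, hnϖ, Complex.ofReal_natCast]
    have hp0C : (p : ℂ) ≠ 0 := by exact_mod_cast hp.ne_zero
    rw [div_pow, hn]
    field_simp
  rw [hpu] at ht2
  -- `T = 2 Re u`, `|a_p|² = p T + 2p`
  obtain ⟨T, hT⟩ : ∃ T : ℝ, T = 2 * u.re := ⟨_, rfl⟩
  have huv : u + conj u = (T : ℂ) := by rw [Complex.add_conj, hT]
  have hcoef := hf.cuspCoeff_eq_frobeniusTrace_of_not_dvd hp hpN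
  have hnorm_ap : ‖cuspCoeff f p‖ ^ 2 = p * T + 2 * p := by
    have h1 : (p : ℂ) * u + conj ((p : ℂ) * u) = (p : ℂ) * (T : ℂ) := by
      rw [map_mul, Complex.conj_natCast, ← mul_add, huv]
    rw [h1] at ht2
    have h2 : ((W.frobeniusTrace p : ℤ) : ℝ) ^ 2 = (p : ℝ) * T + 2 * p := by exact_mod_cast ht2
    rw [hcoef, Complex.norm_intCast, sq_abs, h2]
  -- the good local factor in closed form
  obtain ⟨hyC, hy2C, hpx, hy0, hy1'⟩ := prime_cpow_neg_ofReal hp σ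
  have hy1 := hy1' (by linarith)
  set y : ℝ := (p : ℝ) ^ (-σ) with hy
  have hw : 2 < σ + 1 := by linarith
  have hloc := hf.1.locSq_eq_of_not_dvd hw hp hpN
  have hp0 : (p : ℝ) ≠ 0 := by exact_mod_cast hp.ne_zero
  have hx : (p : ℝ) ^ (-(σ + 1)) = y / p := by
    rw [eq_div_iff hp0, mul_comm]; exact hpx
  have hloc' : locSq f (σ + 1) p = (1 + y) / ((1 - y) * (1 - T * y + y ^ 2)) := by
    rw [hloc, hx, hnorm_ap]
    field_simp
    ring
  -- non-vanishing
  have h1y : (1 : ℂ) + y ≠ 0 := by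
    have : (0 : ℝ) < 1 + y := by linarith
    exact_mod_cast this.ne'
  have h2y : (1 : ℂ) - y ≠ 0 := by
    have : (0 : ℝ) < 1 - y := by linarith
    exact_mod_cast this.ne'
  have hyn : ‖((y : ℝ) : ℂ)‖ < 1 := by rw [Complex.norm_real, Real.norm_of_nonneg hy0.le]; exact hy1
  have hne : ∀ w : ℂ, ‖w‖ ≤ 1 → (1 : ℂ) - w * y ≠ 0 := by
    intro w hw h
    have : w * y = 1 := by linear_combination -h
    have hn := congrArg norm this
    rw [norm_mul, norm_one] at hn
    have : ‖w‖ * ‖((y : ℝ) : ℂ)‖ < 1 := by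
      calc ‖w‖ * ‖((y : ℝ) : ℂ)‖ ≤ 1 * ‖((y : ℝ) : ℂ)‖ := by gcongr
        _ < 1 := by rw [one_mul]; exact hyn
    linarith
  have hnu : ‖u‖ ≤ 1 := hnu1.le
  have hnv : ‖conj u‖ ≤ 1 := by rw [Complex.norm_conj]; exact hnu1.le
  -- assemble
  rw [symmSqLocal, hloc', hy2C, hyC]
  push_cast
  rw [split_algebra h1y h2y (hne _ hnu) (hne _ hnv) huv huv']

/-- **The inert local identity** (`j = 0`). For the newform `f` of a globally minimal `W` with `j = 0`,
real `σ > 1` and a prime `p ≡ 2 (3)` with `p ∤ 6N`: `F_p(σ) = (1 − χ₋₃(p)p^{−σ})⁻¹ · G_p(σ)` (both sides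
equal `((1 − p^{−σ})(1 + p^{−σ})²)⁻¹`: `a_p = 0`, `χ₋₃(p) = −1`, `G_p(σ) = (1 − p^{−2σ})⁻¹`).
[cite: IrelandRosen1990, Ch. 18 §6, proof of Theorem 7] -/
theorem IsNewformOf.symmSqLocal_eq_of_mod_three_eq_two (hf : IsNewformOf W f) (hj : W.j = 0) {σ : ℝ}
    (hσ : 1 < σ) {p : ℕ} (hp : p.Prime) (h6N : ¬ p ∣ 6 * N) (hp3 : p % 3 = 2) :
    symmSqLocal f σ p = (1 - chi3C p * (p : ℂ) ^ (-(σ : ℂ)))⁻¹ * localFactor (dPar W N) 1 2 p σ := by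
  haveI : Fact p.Prime := ⟨hp⟩
  have hp2 : p ≠ 2 := by rintro rfl; exact h6N (dvd_mul_of_dvd_left (by norm_num) _)
  have hpN : ¬ p ∣ N := fun hN ↦ h6N (dvd_mul_of_dvd_right hN 6)
  have hΔ := (hf.not_dvd_minimalDiscriminantInt_of_not_dvd hpN).2
  rw [localFactor_of_mod_three_eq_two (dPar W N) 1 2 hp hp3 hp2 (hf.not_dvd_three_mul_dPar hp h6N),
    chi3C_of_mod_three_eq_two hp3, neg_one_sq, one_mul, neg_one_mul, sub_neg_eq_add]
  obtain ⟨hyC, hy2C, hpx, hy0, hy1'⟩ := prime_cpow_neg_ofReal hp σ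
  have hsqC := prime_sq_cpow_neg_ofReal p σ
  have hy1 := hy1' (by linarith)
  set y : ℝ := (p : ℝ) ^ (-σ) with hy
  -- `a_p = 0`
  have ht0 : W.frobeniusTrace p = 0 :=
    frobeniusTrace_eq_zero_of_j_eq_zero_of_mod_three_eq_two W hj hp hp3 hp2 hΔ
  have hnorm_ap : ‖cuspCoeff f p‖ ^ 2 = 0 := by
    rw [hf.cuspCoeff_eq_frobeniusTrace_of_not_dvd hp hpN, ht0]; simp
  have hw : 2 < σ + 1 := by linarith
  have hloc := hf.1.locSq_eq_of_not_dvd hw hp hpN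
  have hp0 : (p : ℝ) ≠ 0 := by exact_mod_cast hp.ne_zero
  have hx : (p : ℝ) ^ (-(σ + 1)) = y / p := by
    rw [eq_div_iff hp0, mul_comm]; exact hpx
  have hloc' : locSq f (σ + 1) p = (1 + y) / ((1 - y) * (1 + 2 * y + y ^ 2)) := by
    rw [hloc, hx, hnorm_ap, show (p : ℝ) * (y / p) = y by field_simp,
      show (p : ℝ) ^ 2 * (y / p) ^ 2 = y ^ 2 by field_simp,
      show ((0 : ℝ) - 2 * p) * (y / p) = -2 * y by field_simp; ring]
    ring
  have h1y : (1 : ℂ) + y ≠ 0 := by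
    have : (0 : ℝ) < 1 + y := by linarith
    exact_mod_cast this.ne'
  have h2y : (1 : ℂ) - y ≠ 0 := by
    have : (0 : ℝ) < 1 - y := by linarith
    exact_mod_cast this.ne'
  rw [symmSqLocal, hloc', hy2C, hsqC, hyC]
  push_cast
  rw [show (1 : ℂ) + 2 * y + (y : ℂ) ^ 2 = (1 + y) * (1 + y) by ring,
    show (1 : ℂ) - (y : ℂ) ^ 2 = (1 + y) * (1 - y) by ring]
  field_simp

/-! ### The correction factor (generic in the character and the finite set of primes) -/

/-- `1 − χ(p) p^{−σ} ≠ 0` for `σ > 0` and `|χ(p)| ≤ 1`. [folklore] -/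
theorem one_sub_mul_prime_cpow_ne_zero {χ : ℕ → ℂ} {p : ℕ} (hχ : ‖χ p‖ ≤ 1) (hp : p.Prime) {σ : ℝ}
    (hσ : 0 < σ) : (1 : ℂ) - χ p * (p : ℂ) ^ (-(σ : ℂ)) ≠ 0 := by
  intro h
  have h1 : χ p * (p : ℂ) ^ (-(σ : ℂ)) = 1 := by linear_combination -h
  have hn := congrArg norm h1
  rw [norm_mul, norm_one] at hn
  have hy : ‖(p : ℂ) ^ (-(σ : ℂ))‖ < 1 := by
    rw [Complex.norm_natCast_cpow_of_pos hp.pos, neg_re, Complex.ofReal_re]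
    exact Real.rpow_lt_one_of_one_lt_of_neg (by exact_mod_cast hp.one_lt) (by linarith)
  have : ‖χ p‖ * ‖(p : ℂ) ^ (-(σ : ℂ))‖ < 1 := by
    calc ‖χ p‖ * ‖(p : ℂ) ^ (-(σ : ℂ))‖ ≤ 1 * ‖(p : ℂ) ^ (-(σ : ℂ))‖ := by gcongr
      _ < 1 := by rw [one_mul]; exact hy
  linarith

/-- `1 − χ₋₃(p) p^{−σ} ≠ 0` for `σ > 0`. [folklore] -/
theorem one_sub_chi3C_mul_ne_zero {p : ℕ} (hp : p.Prime) {σ : ℝ} (hσ : 0 < σ) :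
    (1 : ℂ) - chi3C p * (p : ℂ) ^ (-(σ : ℂ)) ≠ 0 :=
  one_sub_mul_prime_cpow_ne_zero (χ := fun n : ℕ ↦ chi3C n) (norm_chi3C_le p) hp hσ

variable (f) in
/-- **A finite correction factor** `E(σ) = ∏_{p ∣ M} F_p(σ) (1 − χ(p) p^{−σ})` for a coefficient
sequence `χ` and a modulus `M` (closed forms `symmSqLocalClosed` of the local factors `F_p` of `L_f`):
the shape shared by the CM families (`χ₋₄`, `M = 4|a|` for `j = 1728`; `χ₋₃`, `M = 6N` for `j = 0`).
[folklore] -/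
def cmCorrectionWith (χ : ℕ → ℂ) (M : ℕ) (σ : ℝ) : ℂ :=
  ∏ p ∈ M.primeFactors, symmSqLocalClosed f σ p * (1 - χ p * (p : ℂ) ^ (-(σ : ℂ)))

omit [W.IsGloballyMinimal] in
/-- **`E` is continuous at `σ = 1`** (finite product of closed local factors, whose denominators do
not vanish at `1` by `|a_p|² ≤ 1` at `p ∣ N` and Hasse at `p ∤ N`, and of `1 − χ(p)p^{−σ}`). [folklore] -/
theorem IsNewformOf.continuousAt_cmCorrectionWith_one (hf : IsNewformOf W f) (χ : ℕ → ℂ) (M : ℕ) :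
    ContinuousAt (fun σ : ℝ ↦ cmCorrectionWith f χ M σ) 1 := by
  simp only [cmCorrectionWith]
  refine tendsto_finsetProd _ fun p hp ↦ ?_
  have hpp : p.Prime := Nat.prime_of_mem_primeFactors hp
  have hc1 : Continuous fun σ : ℝ ↦ (p : ℂ) ^ (-((σ : ℂ))) := by
    simpa using continuous_prime_cpow_neg hpp 1
  have hc2 : Continuous fun σ : ℝ ↦ (p : ℂ) ^ (-(2 * (σ : ℂ))) := continuous_prime_cpow_neg hpp 2
  have hchi : ContinuousAt (fun σ : ℝ ↦ (1 : ℂ) - χ p * (p : ℂ) ^ (-(σ : ℂ))) 1 :=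
    (continuous_const.sub (continuous_const.mul hc1)).continuousAt
  refine ContinuousAt.mul ?_ hchi
  -- the closed factor
  obtain ⟨D, hD, hval, -, hbad, hgood⟩ := hf.symmSqLocalClosed_one hpp
  obtain ⟨hyC, hy2C, -, -, -⟩ := prime_cpow_neg_ofReal hpp 1
  by_cases hpN : p ∣ N
  · have hform : (fun σ : ℝ ↦ symmSqLocalClosed f σ p) = fun σ : ℝ ↦ (1 - (p : ℂ) ^ (-(2 * (σ : ℂ))))⁻¹ *
        (1 - ((‖cuspCoeff f p‖ ^ 2 / p : ℝ) : ℂ) * (p : ℂ) ^ (-(σ : ℂ)))⁻¹ * (1 - (p : ℂ) ^ (-(σ : ℂ))) := by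
      funext σ; rw [symmSqLocalClosed, if_pos hpN]
    rw [hform]
    -- non-vanishing at `σ = 1`
    have hp1 : (1 : ℝ) < p := by exact_mod_cast hpp.one_lt
    have hp0 : (0 : ℝ) < p := by linarith
    have hx : (p : ℝ) ^ (-(1 : ℝ)) = 1 / p := by rw [Real.rpow_neg_one]; field_simp
    have hxlt : 1 / (p : ℝ) < 1 := by rw [div_lt_one hp0]; exact hp1
    have ha : ‖cuspCoeff f p‖ ^ 2 ≤ 1 := by
      rw [hf.1.norm_cuspCoeff_sq_of_dvd hpp hpN]; split_ifs <;> norm_num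
    have hne1 : (1 : ℂ) - (p : ℂ) ^ (-(2 * ((1 : ℝ) : ℂ))) ≠ 0 := by
      rw [hy2C, hx]
      have h1p : (0 : ℝ) < 1 / p := by positivity
      have : (0 : ℝ) < 1 - (1 / p) ^ 2 := by nlinarith [hxlt, h1p]
      exact_mod_cast this.ne'
    have hne2 : (1 : ℂ) - ((‖cuspCoeff f p‖ ^ 2 / p : ℝ) : ℂ) * (p : ℂ) ^ (-((1 : ℝ) : ℂ)) ≠ 0 := by
      rw [hyC, hx]
      have : (0 : ℝ) < 1 - ‖cuspCoeff f p‖ ^ 2 / p * (1 / p) := by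
        have h' : ‖cuspCoeff f p‖ ^ 2 / p * (1 / p) ≤ 1 * (1 / p) := by
          gcongr; rw [div_le_one hp0]; linarith
        nlinarith [show (0:ℝ) < 1 / p by positivity]
      exact_mod_cast this.ne'
    exact (((continuous_const.sub hc2).continuousAt.inv₀ hne1).mul
      ((continuous_const.sub (continuous_const.mul hc1)).continuousAt.inv₀ hne2)).mul
      (continuous_const.sub hc1).continuousAt
  · have hform : (fun σ : ℝ ↦ symmSqLocalClosed f σ p) = fun σ : ℝ ↦ ((1 - (p : ℂ) ^ (-(σ : ℂ))) *
        (1 - ((‖cuspCoeff f p‖ ^ 2 / p - 2 : ℝ) : ℂ) * (p : ℂ) ^ (-(σ : ℂ)) + ((p : ℂ) ^ (-(σ : ℂ))) ^ 2))⁻¹ := by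
      funext σ; rw [symmSqLocalClosed, if_neg hpN]
    rw [hform]
    have hD' := hgood hpN
    have hne : (1 - (p : ℂ) ^ (-((1 : ℝ) : ℂ))) *
        (1 - ((‖cuspCoeff f p‖ ^ 2 / p - 2 : ℝ) : ℂ) * (p : ℂ) ^ (-((1 : ℝ) : ℂ)) +
          ((p : ℂ) ^ (-((1 : ℝ) : ℂ))) ^ 2) ≠ 0 := by
      have hx : (p : ℝ) ^ (-(1 : ℝ)) = 1 / p := by rw [Real.rpow_neg_one]; field_simp
      rw [hyC, hx]
      have : ((1 - (1 / (p : ℝ))) * (1 - (‖cuspCoeff f p‖ ^ 2 / p - 2) * (1 / p) + (1 / p) ^ 2) : ℝ) ≠ 0 := by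
        rw [← hD']; exact hD.ne'
      exact_mod_cast this
    exact (((continuous_const.sub hc1).mul ((continuous_const.sub (continuous_const.mul hc1)).add
      (hc1.pow 2))).continuousAt.inv₀ hne)

omit [W.IsGloballyMinimal] in
/-- **`|E(1)| ≥ ∏_{p ∣ M} (1 − 1/p)³`** when `|χ(p)| ≤ 1` (each factor: `|F_p(1)| ≥ (1 − 1/p)²`,
`IsNewformOf.symmSqLocalClosed_one`, and `|1 − χ(p)/p| ≥ 1 − 1/p`). [folklore] -/
theorem IsNewformOf.norm_cmCorrectionWith_one_ge (hf : IsNewformOf W f) {χ : ℕ → ℂ}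
    (hχ : ∀ p : ℕ, ‖χ p‖ ≤ 1) (M : ℕ) :
    ∏ p ∈ M.primeFactors, (1 - 1 / (p : ℝ)) ^ 3 ≤ ‖cmCorrectionWith f χ M 1‖ := by
  rw [cmCorrectionWith, norm_prod]
  refine Finset.prod_le_prod (fun p hp ↦ ?_) (fun p hp ↦ ?_)
  · have hp2 : (2 : ℝ) ≤ p := by exact_mod_cast (Nat.prime_of_mem_primeFactors hp).two_le
    have : 1 / (p : ℝ) ≤ 1 := by rw [div_le_one (by linarith)]; linarith
    exact pow_nonneg (by linarith) 3
  · have hpp : p.Prime := Nat.prime_of_mem_primeFactors hp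
    have hp2 : (2 : ℝ) ≤ p := by exact_mod_cast hpp.two_le
    have hp0 : (0 : ℝ) < p := by linarith
    have hx1 : 1 / (p : ℝ) ≤ 1 := by rw [div_le_one hp0]; linarith
    obtain ⟨D, hD, hval, hge, -, -⟩ := hf.symmSqLocalClosed_one hpp
    obtain ⟨hyC, -, -, -, -⟩ := prime_cpow_neg_ofReal hpp 1
    have hx : (p : ℝ) ^ (-(1 : ℝ)) = 1 / p := by rw [Real.rpow_neg_one]; field_simp
    rw [norm_mul, hval, Complex.norm_real, Real.norm_of_nonneg (inv_nonneg.mpr hD.le),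
      show (1 - 1 / (p : ℝ)) ^ 3 = (1 - 1 / p) ^ 2 * (1 - 1 / p) by ring]
    refine mul_le_mul hge ?_ (by linarith) (inv_nonneg.mpr hD.le)
    have hn : ‖χ p * (p : ℂ) ^ (-((1 : ℝ) : ℂ))‖ ≤ 1 / p := by
      rw [norm_mul, hyC, hx, Complex.norm_real, Real.norm_of_nonneg (by positivity)]
      calc ‖χ p‖ * (1 / (p : ℝ)) ≤ 1 * (1 / p) := by gcongr; exact hχ p
        _ = 1 / p := one_mul _
    have := norm_sub_norm_le (1 : ℂ) (χ p * (p : ℂ) ^ (-((1 : ℝ) : ℂ)))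
    rw [norm_one] at this
    linarith

/-! ### The correction factor of the family `j = 0` and the uniform local identity -/

variable (f) in
/-- **The finite correction factor** `E_W(σ) = ∏_{p ∣ 6N} F_p(σ) (1 − χ₋₃(p) p^{−σ})` of the family
`j = 0` (`cmCorrectionWith` for `χ₋₃` and `M = 6N`). [folklore] -/
def cmCorrection0 (σ : ℝ) : ℂ := cmCorrectionWith f (fun n : ℕ ↦ chi3C n) (6 * N) σ

/-- **The local identity at every prime, uniformly** (`j = 0`): for real `σ > 1`,
`F_p(σ) = (1 − χ₋₃(p)p^{−σ})⁻¹ · G_p(σ) · e_p(σ)` with `e_p = F_p · (1 − χ₋₃(p)p^{−σ})` (closed form)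
at the primes `p ∣ 6N` (where `G_p = 1`, `p ∣ 3 d_W`) and `e_p = 1` at `p ∤ 6N` (split / inert).
[cite: IrelandRosen1990, Ch. 18 §6, proof of Theorem 7] -/
theorem IsNewformOf.symmSqLocal_eq_three0 (hf : IsNewformOf W f) (hj : W.j = 0) {σ : ℝ} (hσ : 1 < σ)
    {p : ℕ} (hp : p.Prime) :
    symmSqLocal f σ p = (1 - chi3C p * (p : ℂ) ^ (-(σ : ℂ)))⁻¹ * localFactor (dPar W N) 1 2 p σ *
      (if p ∈ (6 * N).primeFactors then
        symmSqLocalClosed f σ p * (1 - chi3C p * (p : ℂ) ^ (-(σ : ℂ))) else 1) := by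
  have hM0 : 6 * N ≠ 0 := mul_ne_zero (by norm_num) (NeZero.ne N)
  by_cases hpM : p ∣ 6 * N
  · have hmem : p ∈ (6 * N).primeFactors := Nat.mem_primeFactors.mpr ⟨hp, hpM, hM0⟩
    rw [if_pos hmem, localFactor_of_dvd (dPar W N) 1 2 hp (dvd_three_mul_dPar_of_dvd W N hp hpM),
      mul_one, hf.1.symmSqLocal_eq_closed hσ hp]
    have hne := one_sub_chi3C_mul_ne_zero hp (show (0 : ℝ) < σ by linarith)
    field_simp
  · have hmem : p ∉ (6 * N).primeFactors := fun h ↦ hpM (Nat.dvd_of_mem_primeFactors h)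
    rw [if_neg hmem, mul_one]
    have hp2 : p ≠ 2 := by rintro rfl; exact hpM (dvd_mul_of_dvd_left (by norm_num) _)
    have hp3 : p ≠ 3 := by rintro rfl; exact hpM (dvd_mul_of_dvd_left (by norm_num) _)
    have h3 : p % 3 = 1 ∨ p % 3 = 2 := by
      have : p % 3 ≠ 0 := fun h0 ↦ hp3 ((Nat.prime_dvd_prime_iff_eq Nat.prime_three hp).mp
        (Nat.dvd_of_mod_eq_zero h0)).symm
      omega
    rcases h3 with h1 | h2
    · exact hf.symmSqLocal_eq_of_mod_three_eq_one hj hσ hp hpM h1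
    · exact hf.symmSqLocal_eq_of_mod_three_eq_two hj hσ hp hpM h2

end LocalIdentities0

/-! ### Assembly: `L_f(σ) = L(σ, χ₋₃) · L(σ, ν_W) · E_W(σ)` for `σ > 1` -/

section Assembly0

open _root_.WeierstrassCurve NumberField
open scoped LSeries.notation

variable {W : WeierstrassCurve ℚ} [W.IsElliptic] [W.IsGloballyMinimal] {N : ℕ} [NeZero N]
  {f : CuspForm (Gamma0 N) 2}

omit [W.IsElliptic] in
/-- `d_W ≠ 0` in `𝓞 K3`. [folklore] -/
theorem intCast_dPar_ne_zero : ((dPar W N : ℤ) : 𝓞 K3) ≠ 0 := by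
  exact_mod_cast dPar_ne_zero W N

/-- **`L_f(σ) = L(σ, χ₋₃) · L(σ, ν_W) · E_W(σ)` for real `σ > 1`** (`ν_W = ν_{d_W,1,2}`; comparison of the
Euler products over the rational primes: `L(σ, ν_W) = ∏_p G_p(σ)` by `hasProd_localFactor`, the local
identity `symmSqLocal_eq_three0` at every prime, and the correction is the finite product over `p ∣ 6N`).
[cite: IrelandRosen1990, Ch. 18 §6, proof of Theorem 7] -/
theorem IsNewformOf.symmSqL_ofReal_eq0 (hf : IsNewformOf W f) (hj : W.j = 0) {σ : ℝ} (hσ : 1 < σ) :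
    symmSqL N f σ = L ↗chi3C σ * grossenL ((dPar W N : ℤ) : 𝓞 K3) 1 2 σ * cmCorrection0 f σ := by
  have hσC : 1 < ((σ : ℂ)).re := by simpa using hσ
  set M := 6 * N with hM
  -- the three limits
  have TL : Tendsto (fun n : ℕ ↦ ∏ p ∈ Nat.primesBelow n, (1 - chi3C p * (p : ℂ) ^ (-(σ : ℂ)))⁻¹) atTop
      (𝓝 (L ↗chi3C σ)) := DirichletCharacter.LSeries_eulerProduct chi3C hσC
  have TH : Tendsto (fun n : ℕ ↦ ∏ p ∈ Nat.primesBelow n, localFactor (dPar W N) 1 2 p σ) atTop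
      (𝓝 (grossenL ((dPar W N : ℤ) : 𝓞 K3) 1 2 σ)) := by
    rw [grossenL_eq_LSeries _ 1 2 intCast_dPar_ne_zero (by norm_num) hσC]
    exact tendsto_prod_primesBelow_of_hasProd (g := fun p ↦ localFactor (dPar W N) 1 2 p σ)
      (hasProd_localFactor (dPar W N) 1 2 hσC)
  set e : ℕ → ℂ := fun p ↦ if p ∈ M.primeFactors then
      symmSqLocalClosed f σ p * (1 - chi3C p * (p : ℂ) ^ (-(σ : ℂ))) else 1 with he
  have TE : Tendsto (fun n : ℕ ↦ ∏ p ∈ Nat.primesBelow n, e p) atTop (𝓝 (cmCorrection0 f σ)) := by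
    refine tendsto_const_nhds.congr' ?_
    filter_upwards [eventually_gt_atTop M] with n hn
    have hsub : M.primeFactors ⊆ Nat.primesBelow n := by
      intro p hp
      rw [Nat.mem_primesBelow]
      exact ⟨lt_of_le_of_lt (Nat.le_of_mem_primeFactors hp) hn, Nat.prime_of_mem_primeFactors hp⟩
    rw [he]
    simp only
    rw [Finset.prod_ite_mem, Finset.inter_eq_right.mpr hsub, cmCorrection0, cmCorrectionWith]
  have Tall := (TL.mul TH).mul TE
  have heq : (fun n : ℕ ↦ (∏ p ∈ Nat.primesBelow n, (1 - chi3C p * (p : ℂ) ^ (-(σ : ℂ)))⁻¹) *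
      (∏ p ∈ Nat.primesBelow n, localFactor (dPar W N) 1 2 p σ) *
      ∏ p ∈ Nat.primesBelow n, e p) = fun n ↦ ∏ p ∈ Nat.primesBelow n, symmSqLocal f σ p := by
    funext n
    rw [← Finset.prod_mul_distrib, ← Finset.prod_mul_distrib]
    refine Finset.prod_congr rfl fun p hp ↦ ?_
    rw [he, hf.symmSqLocal_eq_three0 hj hσ (Nat.mem_primesBelow.mp hp).2]
  rw [heq] at Tall
  exact tendsto_nhds_unique (hf.1.tendsto_prod_symmSqLocal hσ) Tall

end Assembly0

/-! ### The passage `σ → 1⁺` -/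

section Limit0

open _root_.WeierstrassCurve NumberField
open scoped LSeries.notation

variable {W : WeierstrassCurve ℚ} [W.IsElliptic] [W.IsGloballyMinimal] {N : ℕ} [NeZero N]
  {f : CuspForm (Gamma0 N) 2}

/-- `σ ↦ L(σ, ν_{D,r,m})` is continuous at `σ = 1` (holomorphy on `Re s > 3/4`). [cite: HeckeMathZ1920, §6] -/
theorem continuousAt_grossenL_ofReal_one {D : 𝓞 K3} (hD0 : D ≠ 0) (r : ℕ) {m : ℕ} (hm : 1 ≤ m) :
    ContinuousAt (fun σ : ℝ ↦ grossenL D r m σ) 1 := by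
  have hU : IsOpen {s : ℂ | 3 / 4 < s.re} := isOpen_lt continuous_const Complex.continuous_re
  have h1 : ((1 : ℝ) : ℂ) ∈ {s : ℂ | 3 / 4 < s.re} := by
    simp only [Set.mem_setOf_eq, Complex.ofReal_one, Complex.one_re]
    norm_num
  have hd : DifferentiableAt ℂ (grossenL D r m) ((1 : ℝ) : ℂ) :=
    (differentiableOn_grossenL D r m hD0 hm).differentiableAt (hU.mem_nhds h1)
  exact hd.continuousAt.comp Complex.continuous_ofReal.continuousAt

omit [W.IsGloballyMinimal] in
/-- **`E_W` is continuous at `σ = 1`.** [folklore] -/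
theorem IsNewformOf.continuousAt_cmCorrection0_one (hf : IsNewformOf W f) :
    ContinuousAt (fun σ : ℝ ↦ cmCorrection0 f σ) 1 :=
  hf.continuousAt_cmCorrectionWith_one (fun n : ℕ ↦ chi3C n) (6 * N)

/-- **`L_f(1) = L(1, χ₋₃) · L(1, ν_W) · E_W(1)`** for the newform of a globally minimal `W` with `j = 0`
(the identity for `σ > 1` and continuity of the four functions at `σ = 1`; `L(s, χ₋₃)` is Mathlib's
`DirichletCharacter.LFunction`, `L(s, ν_W) = grossenL d_W 1 2` is holomorphic on `Re s > 3/4`).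
[cite: IrelandRosen1990, Ch. 18 §6, Theorem 7] [cite: HeckeMathZ1920, §6] -/
theorem IsNewformOf.symmSqL_one_eq0 (hf : IsNewformOf W f) (hj : W.j = 0) :
    symmSqL N f 1 = chi3C.LFunction 1 * grossenL ((dPar W N : ℤ) : 𝓞 K3) 1 2 1 * cmCorrection0 f 1 := by
  have h1 : Tendsto (fun σ : ℝ ↦ symmSqL N f σ) (𝓝[>] 1) (𝓝 (symmSqL N f 1)) := by
    have := (continuousAt_symmSqL_ofReal_one f).tendsto
    simp only [Complex.ofReal_one] at this
    exact this.mono_left nhdsWithin_le_nhds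
  have hL : ContinuousAt (fun σ : ℝ ↦ chi3C.LFunction σ) 1 :=
    (DirichletCharacter.differentiable_LFunction chi3C_ne_one).continuous.continuousAt.comp
      Complex.continuous_ofReal.continuousAt
  have hH : ContinuousAt (fun σ : ℝ ↦ grossenL ((dPar W N : ℤ) : 𝓞 K3) 1 2 σ) 1 :=
    continuousAt_grossenL_ofReal_one intCast_dPar_ne_zero 1 (by norm_num)
  have h2 : Tendsto (fun σ : ℝ ↦ chi3C.LFunction σ * grossenL ((dPar W N : ℤ) : 𝓞 K3) 1 2 σ *
      cmCorrection0 f σ) (𝓝[>] 1)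
      (𝓝 (chi3C.LFunction 1 * grossenL ((dPar W N : ℤ) : 𝓞 K3) 1 2 1 * cmCorrection0 f 1)) := by
    have h2' : ContinuousAt (fun σ : ℝ ↦ chi3C.LFunction σ * grossenL ((dPar W N : ℤ) : 𝓞 K3) 1 2 σ *
        cmCorrection0 f σ) 1 := (hL.mul hH).mul hf.continuousAt_cmCorrection0_one
    convert h2'.tendsto.mono_left nhdsWithin_le_nhds using 2
    simp
  have heq : (fun σ : ℝ ↦ chi3C.LFunction σ * grossenL ((dPar W N : ℤ) : 𝓞 K3) 1 2 σ *
      cmCorrection0 f σ) =ᶠ[𝓝[>] 1] fun σ : ℝ ↦ symmSqL N f σ := by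
    filter_upwards [Ioo_mem_nhdsGT (show (1 : ℝ) < 2 by norm_num)] with σ hσ
    rw [hf.symmSqL_ofReal_eq0 hj hσ.1, DirichletCharacter.LFunction_eq_LSeries chi3C (by simpa using hσ.1)]
  exact tendsto_nhds_unique h1 (h2.congr' heq)

end Limit0

/-! ### Sizes: `|E_W(1)| ≫_δ N^{−δ}`, `|L(1, ν_W)| ≫ (log N)⁻³`, and the main theorems -/

section Bounds0

open _root_.WeierstrassCurve NumberField

variable {W : WeierstrassCurve ℚ} [W.IsElliptic] [W.IsGloballyMinimal] {N : ℕ} [NeZero N]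
  {f : CuspForm (Gamma0 N) 2}

omit [W.IsGloballyMinimal] in
/-- **`|E_W(1)| ≥ ∏_{p ∣ 6N} (1 − 1/p)³`.** [folklore] -/
theorem IsNewformOf.norm_cmCorrection0_one_ge (hf : IsNewformOf W f) :
    ∏ p ∈ (6 * N).primeFactors, (1 - 1 / (p : ℝ)) ^ 3 ≤ ‖cmCorrection0 f 1‖ :=
  hf.norm_cmCorrectionWith_one_ge norm_chi3C_le (6 * N)

/-- `N((n)) = n²` in `𝓞 K3` for a rational integer `n`. [folklore] -/
theorem absNorm_span_intCast_K3 (n : ℤ) : Ideal.absNorm (Ideal.span {((n : ℤ) : 𝓞 K3)}) = n.natAbs ^ 2 := by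
  rw [← mkInt_intCast, absNorm_span_mkInt]
  simp [sq, Int.natAbs_mul]

/-- **`Q(d_W, 2) ≤ 82944 · C_w · N^{10}`** (`Q(D, 2) = 16 C_w N((9D))`, `N((9 d_W)) = 81 d_W²`,
`|d_W| ≤ 8N⁵`): the "conductor" of `L(s, ν_W)` is polynomial in `N`. [folklore] -/
theorem IsNewformOf.condQ_dPar_le (hf : IsNewformOf W f) :
    condQ (((dPar W N : ℤ)) : 𝓞 K3) 2 ≤ 82944 * Cw * (N : ℝ) ^ 10 := by
  have habs : (Ideal.absNorm (Ideal.span {(9 * (((dPar W N : ℤ)) : 𝓞 K3) : 𝓞 K3)}) : ℝ) =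
      81 * ((dPar W N).natAbs : ℝ) ^ 2 := by
    have e : (9 * (((dPar W N : ℤ)) : 𝓞 K3) : 𝓞 K3) = (((9 * dPar W N : ℤ)) : 𝓞 K3) := by
      push_cast
      rfl
    rw [e, absNorm_span_intCast_K3, Int.natAbs_mul]
    have h9 : (9 : ℤ).natAbs = 9 := rfl
    rw [h9]
    push_cast
    ring
  have hd := hf.natAbs_dPar_le
  have hCw := Cw_pos
  rw [condQ, C0, habs]
  push_cast
  calc 4 * Cw * (81 * ((dPar W N).natAbs : ℝ) ^ 2) * 4
      = 1296 * Cw * ((dPar W N).natAbs : ℝ) ^ 2 := by ring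
    _ ≤ 1296 * Cw * (8 * (N : ℝ) ^ 5) ^ 2 := by gcongr
    _ = 82944 * Cw * (N : ℝ) ^ 10 := by ring

/-- **Hoffstein–Lockhart for the CM family `j = 0`, minimal models**: for every `ε > 0` there is
`c > 0` such that for every globally minimal `W/ℚ` with `j(W) = 0` and its newform
`f ∈ S₂(Γ₀(N))`: `c · N^{−ε} ≤ |L_f(1)|` (`L_f(1) = 8π³ Re(f,f)/[SL₂(ℤ):Γ₀(N)]`, the imprimitive
`L(Sym² f, 1)`). Unconditional and effective (in fact `≫ (log N)⁻³ · ∏_{p∣6N}(1−1/p)³`):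
`L_f(1) = L(1, χ₋₃) · L(1, ν_W) · E_W(1)` with `|L(1, ν_W)| ≫ (log Q)⁻³` (no exceptional zero for the
non-real Grössencharakter `ν_W` of `ℚ(ζ₃)`, `TwistedZFRData.exists_const_norm_one_ge`), `Q ≤ 82944 C_w N^{10}`
and `|E_W(1)| ≫_δ (6N)^{−3δ}`.
[cite: HoffsteinLockhart1994, Thm. 0.1 (the CM case)] [cite: IrelandRosen1990, Ch. 18 §6, Theorem 7] -/
theorem IsNewformOf.exists_symmSqL_one_ge_of_isGloballyMinimal_of_j_eq_zero {ε : ℝ} (hε : 0 < ε) :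
    ∃ c : ℝ, 0 < c ∧ ∀ (N : ℕ) [NeZero N] (W : WeierstrassCurve ℚ) [W.IsElliptic] [W.IsGloballyMinimal]
      (f : CuspForm (Gamma0 N) 2), IsNewformOf W f → W.j = 0 →
        c * (N : ℝ) ^ (-ε) ≤ ‖symmSqL N f 1‖ := by
  set δ : ℝ := ε / 33 with hδ
  have hδ0 : 0 < δ := by positivity
  obtain ⟨c₀, hc₀, hH⟩ := exists_norm_grossenL_one_ge
  obtain ⟨K, hK, hKp⟩ := exists_prod_primeFactors_one_add_div_le (C := 2) (by norm_num) hδ0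
  have hL := norm_chi3C_LFunction_one_pos
  have hCw := Cw_pos
  set A₁ : ℝ := 331776 * Cw with hA₁
  have hA₁0 : 0 < A₁ := by positivity
  set A : ℝ := c₀ * δ ^ 3 * A₁ ^ (-(3 * δ)) with hA
  set B : ℝ := (K ^ 3 * (6 : ℝ) ^ (3 * δ))⁻¹ with hB
  have hA0 : 0 < A := by positivity
  have hB0 : 0 < B := by positivity
  refine ⟨‖chi3C.LFunction 1‖ * A * B, by positivity, ?_⟩
  intro N _ W _ _ f hf hj
  have hN0 : (N : ℕ) ≠ 0 := NeZero.ne N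
  have hN1 : (1 : ℝ) ≤ N := by exact_mod_cast Nat.one_le_iff_ne_zero.mpr hN0
  have hN : (0 : ℝ) < N := by linarith
  have hD0 : ((dPar W N : ℤ) : 𝓞 K3) ≠ 0 := intCast_dPar_ne_zero
  -- the identity at `1`
  rw [hf.symmSqL_one_eq0 hj, norm_mul, norm_mul]
  -- (1) `‖L(1, ν_W)‖ ≥ A · N^{-30δ}`
  have hHb : A * (N : ℝ) ^ (-(30 * δ)) ≤ ‖grossenL ((dPar W N : ℤ) : 𝓞 K3) 1 2 1‖ := by
    have h1 := hH ((dPar W N : ℤ) : 𝓞 K3) 1 2 hD0 (by norm_num)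
    set ℒ : ℝ := Real.log (condQ ((dPar W N : ℤ) : 𝓞 K3) 2) + Real.log 4 with hℒ
    have hQ1 : 1 ≤ condQ ((dPar W N : ℤ) : 𝓞 K3) 2 := one_le_condQ _ 2 hD0 (by norm_num)
    have hQ0 : 0 < condQ ((dPar W N : ℤ) : 𝓞 K3) 2 := zero_lt_one.trans_le hQ1
    have hQle : condQ ((dPar W N : ℤ) : 𝓞 K3) 2 ≤ 82944 * Cw * (N : ℝ) ^ 10 := hf.condQ_dPar_le
    have hX0 : (0 : ℝ) < A₁ * N ^ 10 := by positivity
    have hℒle : ℒ ≤ (A₁ * (N : ℝ) ^ 10) ^ δ / δ := by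
      have h4 : ℒ = Real.log (4 * condQ ((dPar W N : ℤ) : 𝓞 K3) 2) := by
        rw [hℒ, ← Real.log_mul hQ0.ne' (by norm_num)]
        congr 1; ring
      rw [h4]
      calc Real.log (4 * condQ ((dPar W N : ℤ) : 𝓞 K3) 2) ≤ Real.log (A₁ * N ^ 10) := by
            refine Real.log_le_log (by positivity) ?_
            calc 4 * condQ ((dPar W N : ℤ) : 𝓞 K3) 2 ≤ 4 * (82944 * Cw * (N : ℝ) ^ 10) := by linarith
              _ = A₁ * N ^ 10 := by rw [hA₁]; ring
        _ ≤ (A₁ * (N : ℝ) ^ 10) ^ δ / δ := Real.log_le_rpow_div hX0.le hδ0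
    have hℒpos : 0 < ℒ := by
      rw [hℒ]
      have : 0 ≤ Real.log (condQ ((dPar W N : ℤ) : 𝓞 K3) 2) := Real.log_nonneg hQ1
      have : 0 < Real.log 4 := Real.log_pos (by norm_num)
      linarith
    have hbound : A * (N : ℝ) ^ (-(30 * δ)) ≤ c₀ / ℒ ^ 3 := by
      have hX : ((A₁ * (N : ℝ) ^ 10) ^ δ / δ) ^ 3 = δ⁻¹ ^ 3 * A₁ ^ (3 * δ) * (N : ℝ) ^ (30 * δ) := by
        rw [div_eq_mul_inv, mul_pow, Real.mul_rpow hA₁0.le (by positivity), mul_pow,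
          ← Real.rpow_natCast (A₁ ^ δ) 3, ← Real.rpow_mul hA₁0.le,
          ← Real.rpow_natCast (((N : ℝ) ^ 10) ^ δ) 3, ← Real.rpow_mul (by positivity),
          show ((N : ℝ) ^ 10) = (N : ℝ) ^ ((10 : ℕ) : ℝ) by rw [Real.rpow_natCast],
          ← Real.rpow_mul hN.le]
        push_cast
        ring_nf
      calc A * (N : ℝ) ^ (-(30 * δ)) = c₀ / (δ⁻¹ ^ 3 * A₁ ^ (3 * δ) * (N : ℝ) ^ (30 * δ)) := by
            rw [hA, Real.rpow_neg hA₁0.le, Real.rpow_neg hN.le]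
            field_simp
        _ = c₀ / ((A₁ * (N : ℝ) ^ 10) ^ δ / δ) ^ 3 := by rw [hX]
        _ ≤ c₀ / ℒ ^ 3 := by
            apply div_le_div_of_nonneg_left hc₀.le (pow_pos hℒpos 3)
            exact pow_le_pow_left₀ hℒpos.le hℒle 3
    exact hbound.trans h1
  -- (2) `‖E(1)‖ ≥ B · N^{-3δ}`
  have hEb : B * (N : ℝ) ^ (-(3 * δ)) ≤ ‖cmCorrection0 f 1‖ := by
    have hM0 : 6 * N ≠ 0 := mul_ne_zero (by norm_num) hN0
    have hP := prod_one_sub_pos (6 * N)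
    have h2 : (K * ((6 * N : ℕ) : ℝ) ^ δ)⁻¹ ≤ ∏ p ∈ (6 * N).primeFactors, (1 - 1 / (p : ℝ)) := by
      refine inv_le_of_inv_le₀ hP ?_
      exact (prod_one_sub_inv_le_prod (6 * N)).trans (hKp (6 * N) hM0)
    have h4 : B * (N : ℝ) ^ (-(3 * δ)) = ((K * ((6 * N : ℕ) : ℝ) ^ δ)⁻¹) ^ 3 := by
      rw [hB]
      push_cast
      rw [Real.mul_rpow (by norm_num) hN.le, Real.rpow_neg hN.le, inv_pow, mul_pow, mul_pow,
        ← Real.rpow_natCast ((6 : ℝ) ^ δ) 3, ← Real.rpow_mul (by norm_num),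
        ← Real.rpow_natCast ((N : ℝ) ^ δ) 3, ← Real.rpow_mul hN.le]
      push_cast
      ring_nf
    rw [h4]
    calc ((K * ((6 * N : ℕ) : ℝ) ^ δ)⁻¹) ^ 3 ≤ (∏ p ∈ (6 * N).primeFactors, (1 - 1 / (p : ℝ))) ^ 3 :=
          pow_le_pow_left₀ (by positivity) h2 3
      _ = ∏ p ∈ (6 * N).primeFactors, (1 - 1 / (p : ℝ)) ^ 3 := (Finset.prod_pow _ 3 _).symm
      _ ≤ ‖cmCorrection0 f 1‖ := hf.norm_cmCorrection0_one_ge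
  -- (3) assemble: `N^{-ε} = N^{-30δ} N^{-3δ}`
  have hsplit : (N : ℝ) ^ (-ε) = (N : ℝ) ^ (-(30 * δ)) * (N : ℝ) ^ (-(3 * δ)) := by
    rw [← Real.rpow_add hN]; congr 1; rw [hδ]; ring
  calc ‖chi3C.LFunction 1‖ * A * B * (N : ℝ) ^ (-ε)
      = ‖chi3C.LFunction 1‖ * (A * (N : ℝ) ^ (-(30 * δ))) * (B * (N : ℝ) ^ (-(3 * δ))) := by
        rw [hsplit]; ring
    _ ≤ ‖chi3C.LFunction 1‖ * ‖grossenL ((dPar W N : ℤ) : 𝓞 K3) 1 2 1‖ * ‖cmCorrection0 f 1‖ := by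
        apply mul_le_mul (mul_le_mul_of_nonneg_left hHb hL.le) hEb (by positivity) (by positivity)

/-- **`L(Sym² f, 1) ≫_ε N^{−ε}` on the newforms of the elliptic curves with `j = 0`** (any Weierstrass
model): for every `ε > 0` there is `c > 0` with `c · N^{−ε} ≤ Re L_f(1)` for every elliptic `W/ℚ` with
`j(W) = 0` and every `f ∈ S₂(Γ₀(N))` with `IsNewformOf W f` (pass to a global minimal model,
`hasGlobalMinimalModel_rat_holds`; `IsNewformOf` and `j` are invariant). This is the `j = 0` part of the
CM case of Hoffstein–Lockhart's theorem, i.e. exactly the hypothesis `hCM0` of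
`murty_petersson_newform_lower_bound_of_pairData_nonCM_of_j_zero`. [cite: HoffsteinLockhart1994, Thm. 0.1 (the CM case)] -/
theorem exists_symmSqL_one_re_ge_of_j_eq_zero {ε : ℝ} (hε : 0 < ε) :
    ∃ c : ℝ, 0 < c ∧ ∀ (N : ℕ) [NeZero N] (W : WeierstrassCurve ℚ) [W.IsElliptic]
      (f : CuspForm (Gamma0 N) 2), IsNewformOf W f → W.j = 0 →
        c * (N : ℝ) ^ (-ε) ≤ (symmSqL N f 1).re := by
  obtain ⟨c, hc, h⟩ := IsNewformOf.exists_symmSqL_one_ge_of_isGloballyMinimal_of_j_eq_zero hε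
  refine ⟨c, hc, fun N _ W _ f hf hj ↦ ?_⟩
  obtain ⟨C, hC⟩ := hasGlobalMinimalModel_rat_holds W
  haveI := hC
  have hf' : IsNewformOf (C • W) f := ⟨hf.1, fun n ↦ by rw [hf.2 n, WeierstrassCurve.LFunction_smul]⟩
  have hj' : (C • W).j = 0 := by rw [WeierstrassCurve.variableChange_j]; exact hj
  rw [symmSqL_one_re_eq_norm]
  exact h N (C • W) f hf' hj'

/-- **The same in the normalisation `symmSqLOne`** (`Re L_f(1) ≤ symmSqLOne f`): the hypothesis `hCM0`
of `murty_petersson_newform_lower_bound_of_pairData_nonCM_of_j_zero`, proved.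
[cite: HoffsteinLockhart1994, Thm. 0.1 (the CM case)] -/
theorem exists_symmSqLOne_ge_of_j_eq_zero {ε : ℝ} (hε : 0 < ε) :
    ∃ c : ℝ, 0 < c ∧ ∀ j : EllipticNewformIndex, j.W.j = 0 →
      c * (j.N : ℝ) ^ (-ε) ≤ symmSqLOne j.f := by
  obtain ⟨c, hc, h⟩ := exists_symmSqL_one_re_ge_of_j_eq_zero hε
  exact ⟨c, hc, fun j hj ↦ (h j.N j.W j.f j.isNewformOf hj).trans (symmSqL_one_re_le_symmSqLOne j.f)⟩

/-- **Murty's / Hoffstein–Lockhart's lower bound for the Petersson norm on the CM family `j = 0`,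
unconditionally**: for every `ε > 0` there is `c > 0` with `c · N^{1−ε} ≤ Re (f, f)_{Γ₀(N)}` for the
newform `f ∈ S₂(Γ₀(N))` of every elliptic curve over `ℚ` with `j = 0` (the curves `y² = x³ + k`)
(`Re L_f(1) = 8π³ Re(f,f)/[SL₂(ℤ):Γ₀(N)]` and `[SL₂(ℤ):Γ₀(N)] ≥ N`). This is the statement of the named
fact `murty_petersson_newform_lower_bound` on that family. [cite: MurtyCongruencePrimes1999, §2 (3)]
[cite: HoffsteinLockhart1994, Thm. 0.1] -/
theorem exists_petersson_ge_of_j_eq_zero {ε : ℝ} (hε : 0 < ε) :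
    ∃ c : ℝ, 0 < c ∧ ∀ (N : ℕ) [NeZero N] (W : WeierstrassCurve ℚ) [W.IsElliptic]
      (f : CuspForm (Gamma0 N) 2), IsNewformOf W f → W.j = 0 →
        c * (N : ℝ) ^ (1 - ε) ≤ (peterssonProduct (Gamma0 N) 2 f f).re := by
  obtain ⟨c, hc, h⟩ := exists_symmSqL_one_re_ge_of_j_eq_zero hε
  refine ⟨c / (8 * π ^ 3), by positivity, fun N _ W _ f hf hj ↦ ?_⟩
  have hN0 : N ≠ 0 := NeZero.ne N
  have hN : (0 : ℝ) < N := by exact_mod_cast Nat.pos_of_ne_zero hN0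
  have hidx : (N : ℝ) ≤ gamma0Index N := by exact_mod_cast le_gamma0Index hN0
  have hidx0 : (0 : ℝ) < gamma0Index N := by exact_mod_cast gamma0Index_pos N
  have hV := re_peterssonProduct_self_nonneg f
  have key := h N W f hf hj
  rw [symmSqL_one, Complex.ofReal_re] at key
  have h1 : c * (N : ℝ) ^ (-ε) ≤ 8 * π ^ 3 * (peterssonProduct (Gamma0 N) 2 f f).re / N :=
    key.trans (div_le_div_of_nonneg_left (by positivity) hN hidx)
  rw [le_div_iff₀ hN] at h1
  have hsplit : (N : ℝ) ^ (1 - ε) = (N : ℝ) ^ (-ε) * N := by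
    rw [show (1 : ℝ) - ε = -ε + 1 by ring, Real.rpow_add hN, Real.rpow_one]
  rw [hsplit, div_mul_eq_mul_div, div_le_iff₀ (by positivity)]
  nlinarith [h1]

end Bounds0

/-! ### The named fact reduced to the `GL₃ × GL₃` pair data alone -/

section Reduction

open _root_.WeierstrassCurve Metric
open scoped ComplexOrder

/-- **Murty's bound `(f, f) ≫_ε N^{1−ε}` ⇐ the `GL₃ × GL₃` pair data for the non-CM, non-twist-equivalent
pairs of elliptic newforms, and nothing else**: the CM hypothesis of
`murty_petersson_newform_lower_bound_of_pairData_nonCM` is now PROVED on every CM newform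
(`j ≠ 0`: `exists_symmSqLOne_ge_of_hasCM_of_j_ne_zero`; `j = 0`: `exists_symmSqLOne_ge_of_j_eq_zero`,
this file). The remaining hypotheses are Hoffstein–Lockhart's Lemma 1.2 / (1.4) for the Rankin–Selberg
convolutions `L(s, F_i × F_j)` of the Gelbart–Jacquet lifts, not yet in the tree.
[cite: HoffsteinLockhart1994, Thm. 0.1, Lemma 1.2] [cite: MurtyCongruencePrimes1999, §2 (3)] -/
theorem murty_petersson_newform_lower_bound_of_pairData_nonCM'
    (P : EllipticNewformIndex → EllipticNewformIndex → ℂ → ℂ)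
    (hPd : ∀ i j, ¬ i.W.HasCM → ¬ j.W.HasCM → ¬ TwistEquiv i j →
      DifferentiableOn ℂ (P i j) (ball (2 : ℂ) (3 / 2)))
    {B₂ κ₂ : ℝ} (hB₂ : 0 ≤ B₂) (hκ₂ : 0 ≤ κ₂)
    (hPle : ∀ i j, ¬ i.W.HasCM → ¬ j.W.HasCM → ¬ TwistEquiv i j → ∀ s ∈ closedBall (2 : ℂ) (3 / 2),
      ‖P i j s‖ ≤ B₂ * ((i.N : ℝ) * j.N) ^ κ₂)
    (hcoeff₃ : ∀ i j, ¬ i.W.HasCM → ¬ j.W.HasCM → ¬ TwistEquiv i j → ∃ a : ℕ → ℂ, 0 ≤ a ∧ a 1 = 1 ∧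
      (∀ s : ℂ, 1 < s.re → LSeriesSummable a s) ∧
      ∀ s : ℂ, 1 < s.re →
        riemannZeta₁ s * (symmSqL i.N i.f s * symmSqL j.N j.f s * P i j s) = (s - 1) * LSeries a s)
    (hP1 : ∀ δ : ℝ, 0 < δ → ∃ T : ℝ, ∀ i j, ¬ i.W.HasCM → ¬ j.W.HasCM → ¬ TwistEquiv i j →
      ‖P i j 1‖ ≤ T * ((i.N : ℝ) * j.N) ^ δ) :
    murty_petersson_newform_lower_bound :=
  murty_petersson_newform_lower_bound_of_pairData_nonCM_of_j_zero
    (fun _ hε ↦ exists_symmSqLOne_ge_of_j_eq_zero hε) P hPd hB₂ hκ₂ hPle hcoeff₃ hP1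

/-- The same with the CM predicate "`j ∈ cmJInvariants`" in place of `HasCM` (no input from the class
number one theorem; the pair data are then required off the thirteen CM `j`-invariants).
[cite: HoffsteinLockhart1994, Thm. 0.1, Lemma 1.2] [cite: MurtyCongruencePrimes1999, §2 (3)] -/
theorem murty_petersson_newform_lower_bound_of_pairData_cmJ'
    (P : EllipticNewformIndex → EllipticNewformIndex → ℂ → ℂ)
    (hPd : ∀ i j, i.W.j ∉ cmJInvariants → j.W.j ∉ cmJInvariants → ¬ TwistEquiv i j →
      DifferentiableOn ℂ (P i j) (ball (2 : ℂ) (3 / 2)))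
    {B₂ κ₂ : ℝ} (hB₂ : 0 ≤ B₂) (hκ₂ : 0 ≤ κ₂)
    (hPle : ∀ i j, i.W.j ∉ cmJInvariants → j.W.j ∉ cmJInvariants → ¬ TwistEquiv i j →
      ∀ s ∈ closedBall (2 : ℂ) (3 / 2), ‖P i j s‖ ≤ B₂ * ((i.N : ℝ) * j.N) ^ κ₂)
    (hcoeff₃ : ∀ i j, i.W.j ∉ cmJInvariants → j.W.j ∉ cmJInvariants → ¬ TwistEquiv i j →
      ∃ a : ℕ → ℂ, 0 ≤ a ∧ a 1 = 1 ∧ (∀ s : ℂ, 1 < s.re → LSeriesSummable a s) ∧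
      ∀ s : ℂ, 1 < s.re →
        riemannZeta₁ s * (symmSqL i.N i.f s * symmSqL j.N j.f s * P i j s) = (s - 1) * LSeries a s)
    (hP1 : ∀ δ : ℝ, 0 < δ → ∃ T : ℝ, ∀ i j, i.W.j ∉ cmJInvariants → j.W.j ∉ cmJInvariants →
      ¬ TwistEquiv i j → ‖P i j 1‖ ≤ T * ((i.N : ℝ) * j.N) ^ δ) :
    murty_petersson_newform_lower_bound :=
  murty_petersson_newform_lower_bound_of_pairData_cmJ_of_j_zero
    (fun _ hε ↦ exists_symmSqLOne_ge_of_j_eq_zero hε) P hPd hB₂ hκ₂ hPle hcoeff₃ hP1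

end Reduction



end Literature.NumberTheory.EllipticCurves.ModularForms

end
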